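import Summits.NavierStokesRegularity.FluidComputer.PalasekTowerHeredityOrBreakdownAt

/-!
# REGISTER v2.3′: heredity or breakdown — what a REFUTATION must now exhibit (survivor-form kill templates)

Cell `ns-blowup`, seat `ns-palasek-19250-p2` (g2). Companion of `PalasekTowerHeredityOrBreakdown{,Ceiling,At}.lean`
(p473253 / p473580 / p474771). LABEL: E–C typing (KERNEL glue; no `Prop` is introduced here). WHAT THIS IS NOT:
not Navier–Stokes evidence — nothing is constructed, asserted or decided; these are the SHAPES a disprover's
witness must have, with and without the clause «no premature breakdown».

## What is proved (every level `k`)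

* `not_heredityOrBreakdownAt_iff` — `¬ HeredityOrBreakdownAt k ↔ ∃ adm S, ∃ s : Stage k, S.LivesTo 1 (τ (k+1)) ∧
  ¬ ∃ s', s.Extends s'`: a kill of the WEAK item needs a registered level-`k` design whose flow SURVIVES window `k`
  and still does not extend (a flow that dies inside the window is (C), never a kill).
* `not_windowCeilingAt_of_surviving_overshoot` / `not_heredityOrBreakdownAt_of_surviving_overshoot` /
  `not_heredityAt_of_surviving_overshoot` — a SURVIVING registered flow (classical finite-energy solution of the
  design's system from the Clay datum on the full slab `[0, τ (k+1)]`) exceeding `c₂ Y_{k+1}` somewhere on the window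
  kills the window ceiling, hence the weak item, hence the item.
* `not_heredityOrBreakdownAt_of_surviving_floor_miss` / `not_heredityAt_of_surviving_floor_miss` — a surviving
  registered flow inside the ceiling that misses one of the three level-`k+1` floors at `τ (k+1)` kills both items
  (survivor form of `ReadoutFloorsAt`; the flow is THE flow by `Stage.velocity_eq_of_classical`, so «misses» may be
  read on any classical finite-energy solution from the datum).
* `not_heredityAt_iff_dies_or_not_orBreakdown` — `¬ HeredityAt k ↔ ¬ NoPrematureBreakdownAt k ∨ ¬ HeredityOrBreakdownAt k`,
  the first disjunct being (C) (`navierStokesBreakdownR3_of_not_noPrematureBreakdownAt`).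

References: S. Palasek, arXiv:2605.13827 §4 [cite: Palasek2026ElementaryModel, §4]; H. Sohr, *The Navier–Stokes
Equations*, Birkhäuser 2001, Ch. V Thm. 1.5.1 [cite: Sohr2001, Ch. V Thm. 1.5.1].
-/

noncomputable section

namespace Summit.NavierStokesRegularity.FluidComputer.PalasekTowerClayBridge

open Set MeasureTheory Filter Topology Function
open scoped ENNReal ContDiff NNReal
open Literature.Analysis.FluidPDE
open Summit.NavierStokesRegularity.NavierStokesRegularity

/-! ## §1 The shape of a kill of the weak item -/

/-- **A kill of `HeredityOrBreakdownAt k` is a SURVIVING registered design that does not extend.** [folklore] -/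
theorem not_heredityOrBreakdownAt_iff (k : ℕ) :
    ¬ HeredityOrBreakdownAt k ↔
      ∃ S : Schedule TowerRates.wide, S.Pins 8 (6 / 5) ∧ S.Rigid ∧ S.Quiet ∧
        ∃ s : Stage 1 TowerRates.wide S (Margins.routeG TowerRates.wide) k,
          S.LivesTo 1 (S.τ (k + 1)) ∧
            ¬ ∃ s' : Stage 1 TowerRates.wide S (Margins.routeG TowerRates.wide) (k + 1), s.Extends s' := by
  constructor
  · intro h
    by_contra hne
    apply h
    intro S hP hR hQ s
    by_cases hlive : S.LivesTo 1 (S.τ (k + 1))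
    · by_cases hext : ∃ s' : Stage 1 TowerRates.wide S (Margins.routeG TowerRates.wide) (k + 1), s.Extends s'
      · exact Or.inr hext
      · exact absurd ⟨S, hP, hR, hQ, s, hlive, hext⟩ hne
    · exact Or.inl hlive
  · rintro ⟨S, hP, hR, hQ, s, hlive, hext⟩ h
    rcases h S hP hR hQ s with hdead | hext'
    · exact hdead hlive
    · exact hext hext'

/-- **`¬ HeredityAt k ↔ ¬ NoPrematureBreakdownAt k ∨ ¬ HeredityOrBreakdownAt k`** — a kill of the register's item is
EITHER a registered design dying inside window `k` (which is (C)) OR a kill of the weak item. [folklore] -/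
theorem not_heredityAt_iff_dies_or_not_orBreakdown (k : ℕ) :
    ¬ HeredityAt k ↔ ¬ NoPrematureBreakdownAt k ∨ ¬ HeredityOrBreakdownAt k := by
  rw [heredityAt_iff_orBreakdown_and_noPrematureBreakdown, not_and_or, or_comm]

/-! ## §2 Survivor-form kill templates -/

section Templates

variable {k : ℕ} {S : Schedule TowerRates.wide}

/-- **A surviving registered flow that overshoots kills the window ceiling.** [cite: Sohr2001, Ch. V Thm. 1.5.1] -/
theorem not_windowCeilingAt_of_surviving_overshoot (hP : S.Pins 8 (6 / 5)) (hR : S.Rigid) (hQ : S.Quiet)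
    (s : Stage 1 TowerRates.wide S (Margins.routeG TowerRates.wide) k)
    {v : ℝ → EuclideanSpace ℝ (Fin 3) → EuclideanSpace ℝ (Fin 3)} {q : ℝ → EuclideanSpace ℝ (Fin 3) → ℝ}
    (hcl : IsClassicalNSSolutionOn (Icc 0 (S.τ (k + 1))) 1 S.f v q) (hv0 : v 0 = S.u₀)
    (hE : ∃ C : ℝ≥0∞, C < ⊤ ∧ ∀ t ∈ Icc 0 (S.τ (k + 1)), ∫⁻ x, ‖v t x‖ₑ ^ 2 ≤ C)
    (hover : ∃ t ∈ Icc (S.τ k) (S.τ (k + 1)), ∃ x, S.c₂ * TowerRates.wide.Y (k + 1) < ‖v t x‖) :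
    ¬ WindowCeilingAt k := by
  intro hW
  obtain ⟨t, ht, x, hx⟩ := hover
  exact absurd (hW S hP hR hQ s v q hcl hv0 hE t ht x) (not_le.2 hx)

/-- … hence kills the weak item at level `k` … [folklore] -/
theorem not_heredityOrBreakdownAt_of_surviving_overshoot (hP : S.Pins 8 (6 / 5)) (hR : S.Rigid) (hQ : S.Quiet)
    (s : Stage 1 TowerRates.wide S (Margins.routeG TowerRates.wide) k)
    {v : ℝ → EuclideanSpace ℝ (Fin 3) → EuclideanSpace ℝ (Fin 3)} {q : ℝ → EuclideanSpace ℝ (Fin 3) → ℝ}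
    (hcl : IsClassicalNSSolutionOn (Icc 0 (S.τ (k + 1))) 1 S.f v q) (hv0 : v 0 = S.u₀)
    (hE : ∃ C : ℝ≥0∞, C < ⊤ ∧ ∀ t ∈ Icc 0 (S.τ (k + 1)), ∫⁻ x, ‖v t x‖ₑ ^ 2 ≤ C)
    (hover : ∃ t ∈ Icc (S.τ k) (S.τ (k + 1)), ∃ x, S.c₂ * TowerRates.wide.Y (k + 1) < ‖v t x‖) :
    ¬ HeredityOrBreakdownAt k :=
  fun h => not_windowCeilingAt_of_surviving_overshoot hP hR hQ s hcl hv0 hE hover h.windowCeilingAt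

/-- … and the register's item at level `k`. [folklore] -/
theorem not_heredityAt_of_surviving_overshoot (hP : S.Pins 8 (6 / 5)) (hR : S.Rigid) (hQ : S.Quiet)
    (s : Stage 1 TowerRates.wide S (Margins.routeG TowerRates.wide) k)
    {v : ℝ → EuclideanSpace ℝ (Fin 3) → EuclideanSpace ℝ (Fin 3)} {q : ℝ → EuclideanSpace ℝ (Fin 3) → ℝ}
    (hcl : IsClassicalNSSolutionOn (Icc 0 (S.τ (k + 1))) 1 S.f v q) (hv0 : v 0 = S.u₀)
    (hE : ∃ C : ℝ≥0∞, C < ⊤ ∧ ∀ t ∈ Icc 0 (S.τ (k + 1)), ∫⁻ x, ‖v t x‖ₑ ^ 2 ≤ C)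
    (hover : ∃ t ∈ Icc (S.τ k) (S.τ (k + 1)), ∃ x, S.c₂ * TowerRates.wide.Y (k + 1) < ‖v t x‖) :
    ¬ HeredityAt k :=
  fun h => not_heredityOrBreakdownAt_of_surviving_overshoot hP hR hQ s hcl hv0 hE hover h.orBreakdown

/-- **A surviving registered flow inside the ceiling that MISSES a level-`k+1` floor kills the weak item**: its slice
at `τ (k+1)` is the extension's (`Stage.velocity_eq_of_classical`), which has all three floors. The miss is stated as
the negation of the conjunction speed ∧ strain ∧ core read on the flow's own slice. [cite: Sohr2001, Ch. V Thm. 1.5.1] -/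
theorem not_heredityOrBreakdownAt_of_surviving_floor_miss (hP : S.Pins 8 (6 / 5)) (hR : S.Rigid) (hQ : S.Quiet)
    (s : Stage 1 TowerRates.wide S (Margins.routeG TowerRates.wide) k)
    {v : ℝ → EuclideanSpace ℝ (Fin 3) → EuclideanSpace ℝ (Fin 3)} {q : ℝ → EuclideanSpace ℝ (Fin 3) → ℝ}
    (hcl : IsClassicalNSSolutionOn (Icc 0 (S.τ (k + 1))) 1 S.f v q) (hv0 : v 0 = S.u₀)
    (hE : ∃ C : ℝ≥0∞, C < ⊤ ∧ ∀ t ∈ Icc 0 (S.τ (k + 1)), ∫⁻ x, ‖v t x‖ₑ ^ 2 ≤ C)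
    (hmiss : ¬ ((∃ x, ‖x‖ ≤ S.radius ∧ S.c₁ * TowerRates.wide.Y (k + 1) ≤ ‖v (S.τ (k + 1)) x‖) ∧
      (∃ x, ‖x‖ ≤ S.radius ∧ S.c₁ * TowerRates.wide.A (k + 1) ≤ ‖fderiv ℝ (v (S.τ (k + 1))) x‖) ∧
      (∃ (x : EuclideanSpace ℝ (Fin 3)) (γ : ℝ → EuclideanSpace ℝ (Fin 3)),
        ‖x‖ ≤ S.radius ∧ ContDiff ℝ 1 γ ∧ γ 0 = γ 1 ∧
        (∀ σ ∈ Icc (0 : ℝ) 1, γ σ ∈ Metric.closedBall x (1 / TowerRates.wide.N (k + 1))) ∧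
        (∀ σ ∈ Icc (0 : ℝ) 1, ‖deriv γ σ‖ ≤ 8 * Real.pi / TowerRates.wide.N (k + 1)) ∧
        S.c₁ * TowerRates.wide.N (k + 1) ^ (TowerRates.wide.β - 2) ≤ circulation (v (S.τ (k + 1))) γ))) :
    ¬ HeredityOrBreakdownAt k := by
  intro h
  rcases h S hP hR hQ s with hdead | ⟨s', -⟩
  · exact hdead ⟨v, q, hcl, hv0, hE⟩
  · have hτ : S.τ (k + 1) ∈ Icc 0 (S.τ (k + 1)) := ⟨(S.τ_pos (k + 1)).le, le_rfl⟩
    apply hmiss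
    rw [s'.velocity_eq_of_classical one_pos le_rfl hcl hv0 hE _ hτ]
    exact ⟨s'.floor (k + 1) le_rfl, s'.routeG_strain (k + 1) le_rfl, s'.routeG_coreLedger (k + 1) le_rfl⟩

/-- … and the register's item at level `k`. [folklore] -/
theorem not_heredityAt_of_surviving_floor_miss (hP : S.Pins 8 (6 / 5)) (hR : S.Rigid) (hQ : S.Quiet)
    (s : Stage 1 TowerRates.wide S (Margins.routeG TowerRates.wide) k)
    {v : ℝ → EuclideanSpace ℝ (Fin 3) → EuclideanSpace ℝ (Fin 3)} {q : ℝ → EuclideanSpace ℝ (Fin 3) → ℝ}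
    (hcl : IsClassicalNSSolutionOn (Icc 0 (S.τ (k + 1))) 1 S.f v q) (hv0 : v 0 = S.u₀)
    (hE : ∃ C : ℝ≥0∞, C < ⊤ ∧ ∀ t ∈ Icc 0 (S.τ (k + 1)), ∫⁻ x, ‖v t x‖ₑ ^ 2 ≤ C)
    (hmiss : ¬ ((∃ x, ‖x‖ ≤ S.radius ∧ S.c₁ * TowerRates.wide.Y (k + 1) ≤ ‖v (S.τ (k + 1)) x‖) ∧
      (∃ x, ‖x‖ ≤ S.radius ∧ S.c₁ * TowerRates.wide.A (k + 1) ≤ ‖fderiv ℝ (v (S.τ (k + 1))) x‖) ∧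
      (∃ (x : EuclideanSpace ℝ (Fin 3)) (γ : ℝ → EuclideanSpace ℝ (Fin 3)),
        ‖x‖ ≤ S.radius ∧ ContDiff ℝ 1 γ ∧ γ 0 = γ 1 ∧
        (∀ σ ∈ Icc (0 : ℝ) 1, γ σ ∈ Metric.closedBall x (1 / TowerRates.wide.N (k + 1))) ∧
        (∀ σ ∈ Icc (0 : ℝ) 1, ‖deriv γ σ‖ ≤ 8 * Real.pi / TowerRates.wide.N (k + 1)) ∧
        S.c₁ * TowerRates.wide.N (k + 1) ^ (TowerRates.wide.β - 2) ≤ circulation (v (S.τ (k + 1))) γ))) :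
    ¬ HeredityAt k :=
  fun h => not_heredityOrBreakdownAt_of_surviving_floor_miss hP hR hQ s hcl hv0 hE hmiss h.orBreakdown

/-- **A registered design that dies inside window `k` kills the register's item but PROVES (C)** — the refutation mode
the weak item discards, with its pay-off made explicit. [cite: FeffermanClay2006, (C)] -/
theorem not_heredityAt_and_breakdownR3_of_dies (hP : S.Pins 8 (6 / 5)) (hR : S.Rigid) (hQ : S.Quiet)
    (s : Stage 1 TowerRates.wide S (Margins.routeG TowerRates.wide) k) (hdead : ¬ S.LivesTo 1 (S.τ (k + 1))) :
    ¬ HeredityAt k ∧ Summit.NavierStokesRegularity.NavierStokesRegularity.NavierStokesBreakdownR3 := by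
  refine ⟨fun h => ?_, s.navierStokesBreakdownR3_of_not_livesTo one_pos (S.τ_pos (k + 1)) hdead⟩
  obtain ⟨s', -⟩ := h S hP hR hQ s
  exact hdead s'.livesTo

end Templates

end Summit.NavierStokesRegularity.FluidComputer.PalasekTowerClayBridge

end
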